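import Summits.HubbardSuperconductivity.HubbardLadder.Bounds.ThermalStiffnessCeilingTPrime
import HarnessLib

/-!
# No stiffness above `T₁` in the canonical `(N↑, N↓)` sectors of the `t–t'` Hubbard torus
# (pub-hubbard BOUNDS, Theorem 13: the sector projection of Theorem 12)

HONEST FRAMING: ladder R1–R4 with certified numbers; no claim on H/H₀. These are rigorous bounds
for a MODEL CLASS (the `t–t'` Hubbard torus in its canonical `(N↑,N↓)` sectors), no materials claim.

Cell tree `Summits/HubbardSuperconductivity/HubbardLadder/Bounds/` (programme-internal statements;
nothing here is a cited Literature fact). bounds.tex §13 (bounds g24, 2026-08-21; v2 of this file =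
v1 (sha256 4e8add88…, the three `I_c1` nodes below, declarations byte-identical) + the SHARP nodes
of the paper's final scheme appended at the end, with PROVED implications sharp ⇒ v1):

* `HighTemperatureTwistInsensitivityTT'CanonicalSharp` (`@[conjecture] def`, PAPER-PROVED,
  bounds.tex Thm 13 (i),(iii) in the certified HEADLINE instance `I_c4`; NOT yet kernel-proved — no
  `_holds` in this file): in the window `β(|t|+|t'|) ≤ 1/1250`, `β|U| ≤ 1/50` (`t = 1` in the
  tree's torus), for every `ε > 0` there is `L₀` — depending on `ε` ONLY — such that for all
  `L ≥ L₀`, every sector `p = (N↑, N↓)` with `L²/4 ≤ N_σ ≤ 3L²/4` and EVERY seam twist `θ`,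
  `|log Re Z_p(0) - log Re Z_p(θ)| ≤ ε`, `Z_p(θ) = partitionFn β ((hubbardTorusTT'Flux L t' U θ).toBlock p p)`
  (the chemical potential and a Zeeman field along `z` are constant on the sector and drop out).
  The paper proves the quantitative form `|1 - Z_p(θ)/Z_p(0)| ≤ E_L` with an explicit `E_L`
  (bounds.tex (13.2)), `E_L ≤ 10^{-7.09}` at `L = 100`, `≤ 10^{-25.9}` at `L = 200`, `≤ 10^{-64.4}`
  at `L = 400`, `≤ 10^{-182}` at `L = 1000`, certified in exact rational arithmetic by two
  independent implementations (`code/canon_kp2_a.py`, `code/canon_kp2_b.py`). Proof in print: `Z_p`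
  is a Fourier coefficient of the grand-canonical partition function at COMPLEX fugacity
  `ζ = s + iφ`; on the arc `|φ|_∞ ≤ φ₀ = 1` Ueltschi's polymer expansion with the Hölder activity
  bound (the phase `e^{iφ·N/β}` is unitary), the single-site normalisation bound
  `|z(s+iφ)|/z(s) ≥ (1 - (1-cos φ₀)/2 - (e^u-cos²φ₀)/4)^{1/2}` (an exact four-term computation using
  the atomic odds identity `p₀₀p₁₁ = e^{-βU}p₁₀p₀₁`; valid up to `φ₀ = π/2`), the Catalan entropy
  bound, the `d`-weighted Kotecký–Preiss tail estimate and the COLUMN LEMMA of Theorem 12 give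
  `|ℓ_θ(ζ) - ℓ_0(ζ)| ≤ 2aL²e^{-bL}` exactly as in the grand-canonical theorem; off the arc every SITE
  loses a fixed fraction of its fugacity weight (`|Z^{gc}(θ;ζ)| ≤ e^{-c₅L²} Z^{gc}(0;s)`); and at the
  centred fugacity the sector has weight `≥ e^{-O(L)}` (Chebyshev from a variance bound by Cauchy's
  estimate on the tube `|Im ζ| ≤ 1`, then a `±1`-particle ratio identity
  `(N↑+1) Z_{p+e↑} = (L²-N↑) Z_p + O(r L² Z_p)` from a commutator series, walked `O(L)` steps).
* `HighTemperatureTwistInsensitivityTT'Canonical` (`@[conjecture] def`; v1 node, the first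
  version's instance `I_c1`: the same statement in the SMALLER window `β(|t|+|t'|) ≤ 10⁻⁴`,
  `β|U| ≤ 1/50`, where `E_L ≤ 10^{-2.16}` at `L = 60`, `≤ 10^{-11.8}` at `L = 100`, `≤ 10^{-80}` at
  `L = 400`, re-certified under the final scheme); PROVED from the sharp node by monotonicity of
  the window (`highTemperatureTwistInsensitivityTT'Canonical_of_sharp`).
* `HighTemperatureNoThermalStiffnessTT'Canonical` (`@[conjecture] def`) — the stiffness reading,
  bounds.tex Thm 13 (ii),(iv): in the same window, for every `ε > 0` there is `L₀(ε)` such that for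
  `L ≥ L₀` every flux stiffness `ρ_s` of a sector free energy in the density window
  (`β ρ_s θ² ≤ log Re Z_p(0) - log Re Z_p(θ)` on `|θ| ≤ θ₀`, the hypothesis shape of the tree's
  `ThermalHalfBathtubStiffnessBoundTT'`) obeys `ρ_s ≤ ε / (β θ₀²)`; PROVED from the insensitivity
  node (`highTemperatureNoThermalStiffnessTT'Canonical_of_insensitivity`).
* `HighTemperatureSectorStiffnessVanishesTT'Canonical` (`@[conjecture] def`) — Thm 13 (iv) at fixed
  temperature: for every `β, θ₀, η > 0` there is `L₀` beyond which every sector flux stiffness in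
  the window is `≤ η`; PROVED from the stiffness node (`..._of_noStiffness`, `..._of_insensitivity`).
* `HighTemperatureSectorStiffnessVanishesTT'CanonicalSharp` (`@[conjecture] def`) — the same
  reading in the sharp window `β(|t|+|t'|) ≤ 1/1250`, `β|U| ≤ 1/50`; PROVED from the sharp
  insensitivity node (`highTemperatureSectorStiffnessVanishesTT'CanonicalSharp_of_sharp`).

What the reading gives (paper, Thm 13 (iv)): for `T ≥ T₁ = max(1250(|t|+|t'|), 50|U|)` every
stiffness functional of the canonical `(N↑,N↓)` free energies with densities in `[1/4, 3/4]` tends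
to `0` as `L → ∞`; hence ANY stiffness-defined `T_c` of these ensembles satisfies `T_c ≤ T₁` with
NO hypothesis. NOT uniform in `U` (the sector-weight floor compares with free ratios); for
`|U| ≤ 25(|t|+|t'|)` the binding condition is `T ≥ 1250(|t|+|t'|) = 7.8 T₀`. The grand-canonical,
`U`-uniform statement is `HighTemperatureNoStiffness.lean` (Theorem 12, `T₀ = 160(|t|+|t'|)`).

References: D. Ueltschi, J. Stat. Phys. 95 (1999) 693, §2.3; R. Kotecký, D. Preiss, Comm. Math.
Phys. 103 (1986) 491; B. Simon, Trace ideals (2005) Thm 2.8; bounds.tex §§12–13;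
`code/canon_kp2_a.py`, `code/canon_kp2_b.py` (certified constants; first version
`code/canon_kp_a.py`, `code/canon_kp_b.py`).
-/

noncomputable section

namespace Summit.HubbardSuperconductivity.HubbardLadder.Bounds

open Matrix Literature.MathematicalPhysics.QuantumLattice
  Literature.MathematicalPhysics.QuantumFieldTheory
open scoped ComplexConjugate ComplexOrder

-- Decidable equality of occupation sets: the tree's shortcut instance
-- `instDecidableEqFinsetOrbFermionTorus` (Bounds/ThermalStiffnessCeilingTPrime.lean) is in scope via
-- the import, so the sector blocks below are the SAME objects as in the tree's thermal stiffness nodes.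

/-! ### The statements -/

/-- **Twist insensitivity of the canonical sector free energies at high temperature**
(bounds.tex Thm 13 (i),(iii), first-version instance `I_c1`; PAPER-PROVED, not yet kernel-proved;
implied by the sharp node `HighTemperatureTwistInsensitivityTT'CanonicalSharp` at the end of this
file, see `highTemperatureTwistInsensitivityTT'Canonical_of_sharp`). In the window
`0 < β`, `β(1+|t'|) ≤ 1/10000`, `β|U| ≤ 1/50`: for every `ε > 0` there is `L₀` (depending on `ε`
only) such that for all `L ≥ L₀` (`L ≥ 3`), all `t' U β` in the window, every sector `(N↑, N↓)` with
`L² ≤ 4N_σ ≤ 3L²` and every seam twist `θ`, `|log Re Z_p(0) - log Re Z_p(θ)| ≤ ε` for the block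
partition functions of `hubbardTorusTT'Flux L t' U θ`. Why it might fail as typed: only if the paper
proof (bounds.tex §13: complex-fugacity polymer expansion on the arc, volume factor off the arc,
Chebyshev + ratio-identity floor; constants certified twice) has a gap. -/
@[conjecture] def HighTemperatureTwistInsensitivityTT'Canonical : Prop :=
  ∀ ε : ℝ, 0 < ε → ∃ L₀ : ℕ, ∀ (L : ℕ) [NeZero L], 3 ≤ L → L₀ ≤ L →
    ∀ (t' U β : ℝ), 0 < β → β * (1 + |t'|) ≤ 1 / 10000 → β * |U| ≤ 1 / 50 →
    ∀ (Nup Ndn : ℕ), L ^ 2 ≤ 4 * Nup → 4 * Nup ≤ 3 * L ^ 2 → L ^ 2 ≤ 4 * Ndn → 4 * Ndn ≤ 3 * L ^ 2 →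
    let p : Finset (Orb (FermionTorus 2 L)) → Prop := fun s =>
      s.card = Nup + Ndn ∧ (s.filter fun i => (ofLex i).2 = 0).card = Nup
    ∀ θ : ℝ,
      |Real.log (partitionFn β ((hubbardTorusTT'Flux L t' U 0).toBlock p p)).re -
          Real.log (partitionFn β ((hubbardTorusTT'Flux L t' U θ).toBlock p p)).re| ≤ ε

/-- **No thermal stiffness above `T₁` in the canonical sectors** (bounds.tex Thm 13 (ii),(iv)).
In the same window, for every `ε > 0` there is `L₀(ε)` such that for `L ≥ L₀` every flux stiffness
`ρ_s` of a sector free energy in the density window — `β ρ_s θ² ≤ log Re Z_p(0) - log Re Z_p(θ)` for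
`|θ| ≤ θ₀`, `θ₀ > 0` — satisfies `ρ_s ≤ ε / (β θ₀²)`; so `ρ_s → 0` as `L → ∞` at fixed `β, θ₀`,
uniformly in `t'`, `U` (in the window) and the sector. PROVED from the insensitivity node below. -/
@[conjecture] def HighTemperatureNoThermalStiffnessTT'Canonical : Prop :=
  ∀ ε : ℝ, 0 < ε → ∃ L₀ : ℕ, ∀ (L : ℕ) [NeZero L], 3 ≤ L → L₀ ≤ L →
    ∀ (t' U β ρs θ₀ : ℝ), 0 < β → β * (1 + |t'|) ≤ 1 / 10000 → β * |U| ≤ 1 / 50 → 0 < θ₀ →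
    ∀ (Nup Ndn : ℕ), L ^ 2 ≤ 4 * Nup → 4 * Nup ≤ 3 * L ^ 2 → L ^ 2 ≤ 4 * Ndn → 4 * Ndn ≤ 3 * L ^ 2 →
    let p : Finset (Orb (FermionTorus 2 L)) → Prop := fun s =>
      s.card = Nup + Ndn ∧ (s.filter fun i => (ofLex i).2 = 0).card = Nup
    (∀ θ : ℝ, |θ| ≤ θ₀ → β * ρs * θ ^ 2 ≤
        Real.log (partitionFn β ((hubbardTorusTT'Flux L t' U 0).toBlock p p)).re -
          Real.log (partitionFn β ((hubbardTorusTT'Flux L t' U θ).toBlock p p)).re) →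
    ρs ≤ ε / (β * θ₀ ^ 2)

/-- **Reduction** (bounds.tex Thm 13 (i) ⇒ (ii)): twist insensitivity of the sector free energies
implies the vanishing bound on every sector flux stiffness — evaluate the stiffness hypothesis at
`θ = θ₀` and divide by `β θ₀² > 0`. -/
theorem highTemperatureNoThermalStiffnessTT'Canonical_of_insensitivity
    (h : HighTemperatureTwistInsensitivityTT'Canonical) :
    HighTemperatureNoThermalStiffnessTT'Canonical := by
  intro ε hε
  obtain ⟨L₀, hL₀⟩ := h ε hε
  refine ⟨L₀, ?_⟩
  intro L _ hL hLL t' U β ρs θ₀ hβ hy hu hθ₀ Nup Ndn h1 h2 h3 h4 p hstiff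
  have hins := hL₀ L hL hLL t' U β hβ hy hu Nup Ndn h1 h2 h3 h4 θ₀
  have hE := hstiff θ₀ (by rw [abs_of_pos hθ₀])
  have hpos : 0 < β * θ₀ ^ 2 := mul_pos hβ (pow_pos hθ₀ 2)
  rw [le_div_iff₀ hpos]
  calc ρs * (β * θ₀ ^ 2) = β * ρs * θ₀ ^ 2 := by ring
    _ ≤ _ := hE
    _ ≤ _ := le_abs_self _
    _ ≤ ε := hins

/-- **The `T_c` reading: sector stiffnesses vanish as `L → ∞`** (bounds.tex Thm 13 (iv)): for every
fixed `β > 0`, `θ₀ > 0` and `η > 0` there is `L₀` beyond which, for all `t'`, `U` with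
`β(1+|t'|) ≤ 10⁻⁴`, `β|U| ≤ 1/50` and every sector in the density window, every flux stiffness on
`|θ| ≤ θ₀` is `≤ η`. PROVED from the stiffness node (take `ε = η β θ₀²`). -/
@[conjecture] def HighTemperatureSectorStiffnessVanishesTT'Canonical : Prop :=
  ∀ (β θ₀ η : ℝ), 0 < β → 0 < θ₀ → 0 < η →
    ∃ L₀ : ℕ, ∀ (L : ℕ) [NeZero L], 3 ≤ L → L₀ ≤ L →
      ∀ (t' U ρs : ℝ), β * (1 + |t'|) ≤ 1 / 10000 → β * |U| ≤ 1 / 50 →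
      ∀ (Nup Ndn : ℕ), L ^ 2 ≤ 4 * Nup → 4 * Nup ≤ 3 * L ^ 2 → L ^ 2 ≤ 4 * Ndn → 4 * Ndn ≤ 3 * L ^ 2 →
      let p : Finset (Orb (FermionTorus 2 L)) → Prop := fun s =>
        s.card = Nup + Ndn ∧ (s.filter fun i => (ofLex i).2 = 0).card = Nup
      (∀ θ : ℝ, |θ| ≤ θ₀ → β * ρs * θ ^ 2 ≤
          Real.log (partitionFn β ((hubbardTorusTT'Flux L t' U 0).toBlock p p)).re -
            Real.log (partitionFn β ((hubbardTorusTT'Flux L t' U θ).toBlock p p)).re) →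
      ρs ≤ η

/-- **Reduction** (Thm 13 (ii) ⇒ (iv)): the stiffness node implies the vanishing of every sector
flux stiffness at fixed temperature, with `ε = η β θ₀²`. -/
theorem highTemperatureSectorStiffnessVanishesTT'Canonical_of_noStiffness
    (h : HighTemperatureNoThermalStiffnessTT'Canonical) :
    HighTemperatureSectorStiffnessVanishesTT'Canonical := by
  intro β θ₀ η hβ hθ₀ hη
  have hε : 0 < η * (β * θ₀ ^ 2) := mul_pos hη (mul_pos hβ (pow_pos hθ₀ 2))
  obtain ⟨L₀, hL₀⟩ := h (η * (β * θ₀ ^ 2)) hε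
  refine ⟨L₀, ?_⟩
  intro L _ hL hLL t' U ρs hy hu Nup Ndn h1 h2 h3 h4 p hstiff
  have := hL₀ L hL hLL t' U β ρs θ₀ hβ hy hu hθ₀ Nup Ndn h1 h2 h3 h4 hstiff
  rwa [mul_div_assoc, div_self (ne_of_gt (mul_pos hβ (pow_pos hθ₀ 2))), mul_one] at this

/-- The two reductions composed: twist insensitivity ⇒ vanishing sector stiffness. -/
theorem highTemperatureSectorStiffnessVanishesTT'Canonical_of_insensitivity
    (h : HighTemperatureTwistInsensitivityTT'Canonical) :
    HighTemperatureSectorStiffnessVanishesTT'Canonical :=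
  highTemperatureSectorStiffnessVanishesTT'Canonical_of_noStiffness
    (highTemperatureNoThermalStiffnessTT'Canonical_of_insensitivity h)

/-! ### The sharp window (bounds.tex Thm 13, final scheme: headline instance `I_c4`)

The paper's final form of Lemma 13.2(c) normalises the complex-fugacity activities by `|z(ζ)|`
with the explicit single-site bound `|z(s+iφ)|²/z(s)² ≥ 1 - (1-cos φ₀)/2 - (e^u-cos²φ₀)/4` on the
tube `|Im ζ|_∞ ≤ φ₀ ≤ π/2`, so the Fourier arc reaches `φ₀ = 1` and the off-arc volume factor gains
`(1-cos 1)/(1-cos(3/5)) ≈ 2.6`; the certified window becomes `β(|t|+|t'|) ≤ 1/1250`, `β|U| ≤ 1/50`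
(`I_c4`: `log₁₀ E_L ≤ -7.09 (L=100), -25.93 (200), -64.44 (400), -182.5 (1000)`; `c₅ ≥ 0.0099`,
`b₁(100) ≤ 0.5448 < b = 9/10`; `code/canon_kp2_a.py`, `code/canon_kp2_b.py`). The nodes below state
it; the `v1` nodes above follow by monotonicity of the window (`1/10000 ≤ 1/1250`). -/

/-- **Twist insensitivity of the canonical sector free energies above `T₁ = max(1250(|t|+|t'|), 50|U|)`**
(bounds.tex Thm 13 (i),(iii), headline instance `I_c4`; PAPER-PROVED, not yet kernel-proved — no
`_holds`). In the window `0 < β`, `β(1+|t'|) ≤ 1/1250`, `β|U| ≤ 1/50`: for every `ε > 0` there is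
`L₀` (depending on `ε` only) such that for all `L ≥ L₀` (`L ≥ 3`), all `t' U β` in the window,
every sector `(N↑, N↓)` with `L² ≤ 4N_σ ≤ 3L²` and every seam twist `θ`,
`|log Re Z_p(0) - log Re Z_p(θ)| ≤ ε`. Why it might fail as typed: only if the paper proof
(bounds.tex §13, final scheme; constants certified twice) has a gap. -/
@[conjecture] def HighTemperatureTwistInsensitivityTT'CanonicalSharp : Prop :=
  ∀ ε : ℝ, 0 < ε → ∃ L₀ : ℕ, ∀ (L : ℕ) [NeZero L], 3 ≤ L → L₀ ≤ L →
    ∀ (t' U β : ℝ), 0 < β → β * (1 + |t'|) ≤ 1 / 1250 → β * |U| ≤ 1 / 50 →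
    ∀ (Nup Ndn : ℕ), L ^ 2 ≤ 4 * Nup → 4 * Nup ≤ 3 * L ^ 2 → L ^ 2 ≤ 4 * Ndn → 4 * Ndn ≤ 3 * L ^ 2 →
    let p : Finset (Orb (FermionTorus 2 L)) → Prop := fun s =>
      s.card = Nup + Ndn ∧ (s.filter fun i => (ofLex i).2 = 0).card = Nup
    ∀ θ : ℝ,
      |Real.log (partitionFn β ((hubbardTorusTT'Flux L t' U 0).toBlock p p)).re -
          Real.log (partitionFn β ((hubbardTorusTT'Flux L t' U θ).toBlock p p)).re| ≤ ε

/-- **Monotonicity of the window**: the sharp node implies the first-version node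
(`β(1+|t'|) ≤ 1/10000 ≤ 1/1250`). -/
theorem highTemperatureTwistInsensitivityTT'Canonical_of_sharp
    (h : HighTemperatureTwistInsensitivityTT'CanonicalSharp) :
    HighTemperatureTwistInsensitivityTT'Canonical := by
  intro ε hε
  obtain ⟨L₀, hL₀⟩ := h ε hε
  refine ⟨L₀, ?_⟩
  intro L _ hL hLL t' U β hβ hy hu Nup Ndn h1 h2 h3 h4 p θ
  have hy' : β * (1 + |t'|) ≤ 1 / 1250 := le_trans hy (by norm_num)
  exact hL₀ L hL hLL t' U β hβ hy' hu Nup Ndn h1 h2 h3 h4 θ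

/-- **The `T_c` reading in the sharp window** (bounds.tex Thm 13 (iv), `T₁ = max(1250(|t|+|t'|), 50|U|)`):
for every fixed `β > 0`, `θ₀ > 0` and `η > 0` there is `L₀` beyond which, for all `t'`, `U` with
`β(1+|t'|) ≤ 1/1250`, `β|U| ≤ 1/50` and every sector in the density window, every flux stiffness
`ρ_s` (`β ρ_s θ² ≤ log Re Z_p(0) - log Re Z_p(θ)` on `|θ| ≤ θ₀`) is `≤ η`. PROVED from the sharp
insensitivity node (take `ε = η β θ₀²`, evaluate the stiffness hypothesis at `θ = θ₀`). -/
@[conjecture] def HighTemperatureSectorStiffnessVanishesTT'CanonicalSharp : Prop :=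
  ∀ (β θ₀ η : ℝ), 0 < β → 0 < θ₀ → 0 < η →
    ∃ L₀ : ℕ, ∀ (L : ℕ) [NeZero L], 3 ≤ L → L₀ ≤ L →
      ∀ (t' U ρs : ℝ), β * (1 + |t'|) ≤ 1 / 1250 → β * |U| ≤ 1 / 50 →
      ∀ (Nup Ndn : ℕ), L ^ 2 ≤ 4 * Nup → 4 * Nup ≤ 3 * L ^ 2 → L ^ 2 ≤ 4 * Ndn → 4 * Ndn ≤ 3 * L ^ 2 →
      let p : Finset (Orb (FermionTorus 2 L)) → Prop := fun s =>
        s.card = Nup + Ndn ∧ (s.filter fun i => (ofLex i).2 = 0).card = Nup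
      (∀ θ : ℝ, |θ| ≤ θ₀ → β * ρs * θ ^ 2 ≤
          Real.log (partitionFn β ((hubbardTorusTT'Flux L t' U 0).toBlock p p)).re -
            Real.log (partitionFn β ((hubbardTorusTT'Flux L t' U θ).toBlock p p)).re) →
      ρs ≤ η

/-- **Reduction** (sharp insensitivity ⇒ sharp vanishing of every sector flux stiffness). -/
theorem highTemperatureSectorStiffnessVanishesTT'CanonicalSharp_of_sharp
    (h : HighTemperatureTwistInsensitivityTT'CanonicalSharp) :
    HighTemperatureSectorStiffnessVanishesTT'CanonicalSharp := by
  intro β θ₀ η hβ hθ₀ hη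
  have hpos : 0 < β * θ₀ ^ 2 := mul_pos hβ (pow_pos hθ₀ 2)
  obtain ⟨L₀, hL₀⟩ := h (η * (β * θ₀ ^ 2)) (mul_pos hη hpos)
  refine ⟨L₀, ?_⟩
  intro L _ hL hLL t' U ρs hy hu Nup Ndn h1 h2 h3 h4 p hstiff
  have hins := hL₀ L hL hLL t' U β hβ hy hu Nup Ndn h1 h2 h3 h4 θ₀
  have hE := hstiff θ₀ (by rw [abs_of_pos hθ₀])
  have hle : ρs * (β * θ₀ ^ 2) ≤ η * (β * θ₀ ^ 2) :=
    calc ρs * (β * θ₀ ^ 2) = β * ρs * θ₀ ^ 2 := by ring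
      _ ≤ _ := hE
      _ ≤ _ := le_abs_self _
      _ ≤ η * (β * θ₀ ^ 2) := hins
  exact le_of_mul_le_mul_right hle hpos

/-- The first-version `T_c` reading also follows from the sharp node. -/
theorem highTemperatureSectorStiffnessVanishesTT'Canonical_of_sharp
    (h : HighTemperatureTwistInsensitivityTT'CanonicalSharp) :
    HighTemperatureSectorStiffnessVanishesTT'Canonical :=
  highTemperatureSectorStiffnessVanishesTT'Canonical_of_insensitivity
    (highTemperatureTwistInsensitivityTT'Canonical_of_sharp h)

end Summit.HubbardSuperconductivity.HubbardLadder.Bounds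

end
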